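import Mathlib.RepresentationTheory.Homological.GroupCohomology.LowDegree
import Mathlib.LinearAlgebra.BilinearForm.Properties
import Mathlib.LinearAlgebra.Dual.Lemmas
import Mathlib.LinearAlgebra.Isomorphisms
import Mathlib.Algebra.Module.Submodule.Union
import Mathlib.Algebra.Ring.Rat
import Literature.AlgebraicGeometry.HodgeTheory.LocallyTrivialExtensionClasses

/-!
# Route LinearSystemTorelli — crux `LocalTubeSpan`: the normal-crossing nodal stratum

Helper file (`--supports stmt-HodgeConjecture-2490`, line `Sketch`, stub `stub_ncNodal`, taken by
the line lead). At a point `s₀` of the discriminant `Δ` where `n` smooth local branches of `Δ` meet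
transversally (the generic point of the codimension-`n` stratum of `Sing Δ` for `d ≫ 0`), the local
fundamental group is `ℤⁿ`, generated by the meridians `t_1, …, t_n` of the branches, which act on
the vanishing cohomology `V` by COMMUTING Picard–Lefschetz transvections
`t_i(x) = x - ⟨x, δ_i⟩ δ_i` along mutually orthogonal, non-zero vanishing cycles `δ_i`
(`⟨δ_i, δ_j⟩ = 0`; the `δ_i` may be linearly DEPENDENT, e.g. `δ_3 = δ_1 + δ_2` at a member
acquiring a third node on the "sum" cycle, and the relations among them are exactly the locally
visible classes). The local Schnell theorem there — refuter g0's nodal lemma, the `p = 1` sanity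
check of every crux idea card ("detecting word `γ₁²γ₂²γ₃⁻¹` for `δ₃ = δ₁ + δ₂`") — says that
Schnell's third map `H¹(ℤⁿ, V) → ∏_g V/(g - 1)V` is nevertheless injective:

* `localTubeSpan_injective_evalCoinv_of_orthogonal_transvections` — for a group `G` generated by
  `t_1, …, t_n` acting on a finite-dimensional `ℚ`-space with a nondegenerate bilinear form `B` by
  `t_i(x) = x - B(x, δ_i) δ_i`, `B(δ_i, δ_j) = 0`, `δ_i ≠ 0`, the third map is injective.

No transvection FRAME exists here (the linear local group is abelian, cf. the companion file
`LinearSystemTorelliLocalTubeSpanFrame`); detection comes from RANK-DROP elements: writing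
`R ⊆ ℚⁿ` for the relations among the `δ_i`, a cocycle undetected on the generators has
`φ(t_i) = α_i δ_i`, it is a coboundary iff `α ⊥ R`, and the element `∏ t_i^{a_i}` detects `α` as
soon as `diag(a)μ = r` for some `r ∈ R` with `r·α ≠ 0` and some `μ ⊥ R` — such `r, μ` with a
common support exist by a generic-choice argument (a vector space over an infinite field is not a
finite union of proper subspaces, Mathlib `Module.Dual.exists_forall_mem_ne_zero_of_forall_exists`),
and the exponents can be taken INTEGRAL because everything is defined over `ℚ` (this is why the
statement is over `ℚ`: the walls `{a : det … = 0}` are linear in `1/a_i` and have rational points —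
contrast the corner modules of the crux's `CornerDetectionNoGo` note, where the rank-drop locus
`a₁² + 3a₁a₂ + a₂² = 0` has none).

Reference for the setting: C. Schnell, *Primitive cohomology and the tube mapping*, Math. Z. 268
(2010) §3 (the third map), §7; the Picard–Lefschetz formula: C. Voisin, *Hodge Theory and Complex
Algebraic Geometry II* (2003) Thm. 3.16. The lemma itself is elementary linear algebra (no named
facts).
-/

-- `Summit.HodgeConjecture.HodgeConjecture.Theorems` is the mandated namespace (single-conjunct summit:
-- Sub = Summit), which `linter.dupNamespace` flags on every declaration; the lakefile turns the
-- linter off tree-wide (weak option), restated here so stand-alone elaboration is warning-free too.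
set_option linter.dupNamespace false

noncomputable section

open CategoryTheory groupCohomology
open Literature.AlgebraicGeometry.HodgeTheory

namespace Summit.HodgeConjecture.HodgeConjecture.Theorems

section General

universe u

variable {k G : Type u} [CommRing k] [Group G] (A : Rep k G)

/-- Two `1`-cocycles that agree on a generating set agree everywhere; stated for the difference:
a cocycle vanishing on a generating set vanishes identically. [folklore] -/
theorem localTubeSpan_cocycles₁_eq_zero_of_closure_eq_top (φ : cocycles₁ A) (s : Set G)
    (hs : Subgroup.closure s = ⊤) (h0 : ∀ g ∈ s, (φ : G → A.V) g = 0) (g : G) :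
    (φ : G → A.V) g = 0 := by
  have hg : g ∈ Subgroup.closure s := by rw [hs]; exact Subgroup.mem_top g
  induction hg using Subgroup.closure_induction with
  | mem g hg => exact h0 g hg
  | one => exact cocycles₁_map_one φ
  | mul g h _ _ ihg ihh => rw [(mem_cocycles₁_iff φ).1 φ.2 g h, ihg, ihh, map_zero, add_zero]
  | inv g _ ih =>
      have h1 := cocycles₁_map_inv φ g
      rw [ih, neg_zero] at h1
      have h2 := congrArg (A.ρ g⁻¹) h1
      rwa [Representation.inv_self_apply, map_zero] at h2

end General

section Rational

variable {G : Type} [Group G] (A : Rep ℚ G)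

/-- Integrality bookkeeping: finitely many rationals have a common positive integer multiplier
making them all integral (product of the denominators). [folklore] -/
theorem localTubeSpan_exists_common_den {n : ℕ} (q : Fin n → ℚ) :
    ∃ (d : ℕ) (a : Fin n → ℤ), 0 < d ∧ ∀ i, (a i : ℚ) = d * q i := by
  classical
  refine ⟨∏ i, (q i).den, fun i => (∏ k ∈ Finset.univ.erase i, ((q k).den : ℤ)) * (q i).num,
    Finset.prod_pos fun i _ => (q i).den_pos, fun i => ?_⟩
  rw [← Finset.prod_erase_mul Finset.univ (fun k => (q k).den) (Finset.mem_univ i)]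
  push_cast
  rw [mul_assoc, Rat.den_mul_eq_num]

/-- **The normal-crossing nodal lemma** (local Schnell theorem at transversal nodal points of the
discriminant). Let `G`, generated by `t_1, …, t_n`, act on a finite-dimensional `ℚ`-space `A` with
a nondegenerate bilinear form `B` through Picard–Lefschetz transvections
`t_i(x) = x - B(x, δ_i) δ_i` along mutually `B`-orthogonal non-zero vectors `δ_i`. Then Schnell's
third map `H¹(G, A) → ∏_{g ∈ G} A/(g - 1)A` is injective: every non-zero class is detected by a
single element `∏ t_i^{a_i}`. [folklore] -/
theorem localTubeSpan_injective_evalCoinv_of_orthogonal_transvections [FiniteDimensional ℚ A.V]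
    (B : LinearMap.BilinForm ℚ A.V) (hB : B.Nondegenerate)
    {n : ℕ} (t : Fin n → G) (ht : Subgroup.closure (Set.range t) = ⊤)
    (δ : Fin n → A.V) (hδ : ∀ i, δ i ≠ 0)
    (hPL : ∀ (i : Fin n) (x : A.V), A.ρ (t i) x = x - B x (δ i) • δ i)
    (horth : ∀ i j, B (δ i) (δ j) = 0) :
    Function.Injective (evalCoinv A) := by
  classical
  refine (injective_iff_map_eq_zero _).2 fun ξ hξ => ?_
  induction ξ using H1_induction_on with
  | h φ =>
  -- undetected by every element
  have hund : ∀ g : G, ∃ v : A.V, A.ρ g v - v = (φ : G → A.V) g := fun g => by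
    have := congr_fun hξ g
    rw [evalCoinv_H1π, Pi.zero_apply, Submodule.mkQ_apply, Submodule.Quotient.mk_eq_zero] at this
    obtain ⟨v, hv⟩ := this
    exact ⟨v, hv⟩
  -- Step 0: the values on the generators, `φ(t_i) = α_i δ_i`
  have hα : ∀ i, ∃ a : ℚ, (φ : G → A.V) (t i) = a • δ i := fun i => by
    obtain ⟨v, hv⟩ := hund (t i)
    refine ⟨-B v (δ i), ?_⟩
    rw [← hv, hPL, neg_smul]
    abel
  choose α hα using hα
  -- Step 1: every integer vector `a` is realised by an element acting as `x ↦ x - Σ aᵢ B(x,δᵢ) δᵢ`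
  -- on which `φ` takes the value `Σ aᵢ αᵢ δᵢ` (the realisable `a` form a subgroup of `ℤⁿ`
  -- containing the basis vectors).
  have hreal : ∀ a : Fin n → ℤ, ∃ g : G,
      (∀ x : A.V, A.ρ g x = x - ∑ i, ((a i : ℚ) * B x (δ i)) • δ i) ∧
      (φ : G → A.V) g = ∑ i, ((a i : ℚ) * α i) • δ i := by
    -- elements of the form above fix every `δ_j`
    have hfix : ∀ (g : G) (a : Fin n → ℤ),
        (∀ x : A.V, A.ρ g x = x - ∑ i, ((a i : ℚ) * B x (δ i)) • δ i) →
        ∀ j, A.ρ g (δ j) = δ j := fun g a hg j => by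
      rw [hg]
      simp [horth]
    let S : AddSubgroup (Fin n → ℤ) :=
      { carrier := {a | ∃ g : G,
          (∀ x : A.V, A.ρ g x = x - ∑ i, ((a i : ℚ) * B x (δ i)) • δ i) ∧
          (φ : G → A.V) g = ∑ i, ((a i : ℚ) * α i) • δ i}
        zero_mem' := ⟨1, fun x => by simp, by simp⟩
        add_mem' := by
          rintro a b ⟨g, hg, hφg⟩ ⟨h, hh, hφh⟩
          refine ⟨g * h, fun x => ?_, ?_⟩
          · rw [map_mul, Module.End.mul_apply, hh, map_sub, hg, map_sum]
            simp only [map_smul, hfix g a hg, Pi.add_apply, Int.cast_add, add_mul, add_smul,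
              Finset.sum_add_distrib]
            abel
          · rw [(mem_cocycles₁_iff φ).1 φ.2 g h, hφh, hφg, map_sum]
            simp only [map_smul, hfix g a hg, Pi.add_apply, Int.cast_add, add_mul, add_smul,
              Finset.sum_add_distrib]
            abel
        neg_mem' := by
          rintro a ⟨g, hg, hφg⟩
          have hinv : ∀ x : A.V, A.ρ g⁻¹ x = x + ∑ i, ((a i : ℚ) * B x (δ i)) • δ i := fun x => by
            have key : A.ρ g (x + ∑ i, ((a i : ℚ) * B x (δ i)) • δ i) = x := by
              rw [map_add, map_sum, hg]
              simp only [map_smul, hfix g a hg]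
              abel
            have := congrArg (A.ρ g⁻¹) key
            rw [Representation.inv_self_apply] at this
            exact this.symm
          refine ⟨g⁻¹, fun x => ?_, ?_⟩
          · rw [hinv]
            simp only [Pi.neg_apply, Int.cast_neg, neg_mul, neg_smul, Finset.sum_neg_distrib]
            abel
          · have h1 : (φ : G → A.V) g⁻¹ = -(A.ρ g⁻¹ ((φ : G → A.V) g)) := by
              have := congrArg (A.ρ g⁻¹) (cocycles₁_map_inv φ g)
              rwa [Representation.inv_self_apply, map_neg] at this
            have hfix' : ∀ j, A.ρ g⁻¹ (δ j) = δ j := fun j => by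
              conv_lhs => rw [← hfix g a hg j]
              rw [Representation.inv_self_apply]
            rw [h1, hφg, map_sum]
            simp only [map_smul, hfix', Pi.neg_apply, Int.cast_neg, neg_mul, neg_smul,
              Finset.sum_neg_distrib] }
    have hsingle : ∀ i, (Pi.single i (1 : ℤ) : Fin n → ℤ) ∈ S := fun i =>
      ⟨t i, fun x => by
        rw [hPL]
        congr 1
        rw [Finset.sum_eq_single i (fun j _ hj => by simp [Pi.single_eq_of_ne hj])
          (fun h => absurd (Finset.mem_univ i) h)]
        simp, by
        rw [hα]
        rw [Finset.sum_eq_single i (fun j _ hj => by simp [Pi.single_eq_of_ne hj])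
          (fun h => absurd (Finset.mem_univ i) h)]
        simp⟩
    intro a
    have ha : a ∈ S := by
      rw [← Finset.univ_sum_single a]
      refine S.sum_mem fun i _ => ?_
      have : (Pi.single i (a i) : Fin n → ℤ) = a i • (Pi.single i (1 : ℤ) : Fin n → ℤ) := by
        ext j
        by_cases h : j = i
        · subst h; simp
        · simp [Pi.single_eq_of_ne h]
      rw [this]
      exact S.zsmul_mem (hsingle i) _
    exact ha
  -- Step 2: the relation space `R` and the reduction to `α ⊥ R`
  let E : (Fin n → ℚ) →ₗ[ℚ] A.V := Fintype.linearCombination ℚ δ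
  have hE : ∀ c, E c = ∑ i, c i • δ i := fun c => Fintype.linearCombination_apply ℚ δ c
  let ℓ : (Fin n → ℚ) →ₗ[ℚ] ℚ := Fintype.linearCombination ℚ α
  have hℓ : ∀ c, ℓ c = ∑ i, c i * α i := fun c => by
    rw [Fintype.linearCombination_apply]; rfl
  suffices hperp : ∀ r, E r = 0 → ℓ r = 0 by
    -- construct `v` with `B v δ_i = -α_i`, then `φ = d v`
    have hker : LinearMap.ker E ≤ LinearMap.ker ℓ := fun r hr => hperp r hr
    let f₀ : LinearMap.range E →ₗ[ℚ] ℚ :=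
      (LinearMap.ker E).liftQ ℓ hker ∘ₗ (E.quotKerEquivRange).symm.toLinearMap
    let f : Module.Dual ℚ A.V := Subspace.dualLift (LinearMap.range E) f₀
    have hf : ∀ c, f (E c) = ℓ c := fun c => by
      change Subspace.dualLift (LinearMap.range E) f₀ (E c) = ℓ c
      rw [Subspace.dualLift_of_mem (LinearMap.mem_range_self E c)]
      change (LinearMap.ker E).liftQ ℓ hker ((E.quotKerEquivRange).symm ⟨E c, _⟩) = ℓ c
      rw [LinearMap.quotKerEquivRange_symm_apply_image E c (LinearMap.mem_range_self E c)]
      rfl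
    let v : A.V := -((B.toDual hB).symm f)
    have hv : ∀ i, B v (δ i) = -α i := fun i => by
      have e1 : B ((B.toDual hB).symm f) (δ i) = f (δ i) := by
        rw [← LinearMap.BilinForm.toDual_def hB, LinearEquiv.apply_symm_apply]
      have e2 : δ i = E (Pi.single i 1) := by
        rw [Fintype.linearCombination_apply_single, one_smul]
      rw [map_neg, LinearMap.neg_apply, e1, e2, hf, hℓ,
        Finset.sum_eq_single i (fun j _ hj => by simp [Pi.single_eq_of_ne hj])
          (fun h => absurd (Finset.mem_univ i) h)]
      simp
    rw [H1π_eq_zero_iff, mem_coboundaries₁_iff_exists]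
    refine ⟨v, fun g => ?_⟩
    -- `φ - d v` vanishes on the generators, hence everywhere
    have key := localTubeSpan_cocycles₁_eq_zero_of_closure_eq_top A
      (φ - ⟨d₀₁ A v, d₀₁_apply_mem_cocycles₁ v⟩) (Set.range t) ht (by
        rintro _ ⟨i, rfl⟩
        change (φ : G → A.V) (t i) - d₀₁ A v (t i) = 0
        rw [d₀₁_hom_apply, hα, hPL, hv]
        simp) g
    change (φ : G → A.V) g - d₀₁ A v g = 0 at key
    rw [d₀₁_hom_apply, sub_eq_zero] at key
    exact key.symm
  -- Step 3: `α ⊥ R`, by exhibiting a detecting element otherwise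
  by_contra hcon
  simp only [not_forall] at hcon
  obtain ⟨r₀, hr₀E, hr₀ℓ⟩ := hcon
  let R : Submodule ℚ (Fin n → ℚ) := LinearMap.ker E
  let J : Finset (Fin n) := Finset.univ.filter fun j => ∃ r ∈ R, r j ≠ 0
  have hJ : ∀ j, j ∈ J ↔ ∃ r ∈ R, r j ≠ 0 := fun j => by simp [J]
  have hnotJ : ∀ i, i ∉ J → ∀ r ∈ R, r i = 0 := fun i hi r hr => by
    by_contra h
    exact hi ((hJ i).2 ⟨r, hr, h⟩)
  -- (3a) a relation `r` with full support `J` and `ℓ r ≠ 0`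
  obtain ⟨r, hrR, hr⟩ : ∃ r ∈ R, (∀ j : J, r j ≠ 0) ∧ ℓ r ≠ 0 := by
    let fam : Option J → Module.Dual ℚ (Fin n → ℚ) := fun o =>
      Option.elim o ℓ fun j => LinearMap.proj (j : Fin n)
    have hw : ∀ o, ∃ x ∈ R, fam o x ≠ 0 := by
      rintro (_ | j)
      · exact ⟨r₀, hr₀E, hr₀ℓ⟩
      · obtain ⟨r, hr, hrj⟩ := (hJ j).1 j.2
        exact ⟨r, hr, hrj⟩
    obtain ⟨x, hxR, hx⟩ := Module.Dual.exists_forall_mem_ne_zero_of_forall_exists R fam hw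
    exact ⟨x, hxR, fun j => hx (some j), hx none⟩
  -- (3b) a functional `f` killing `R` and the coordinates outside `J`, non-zero on `e_j`, `j ∈ J`
  let Z : Submodule ℚ (Fin n → ℚ) := ⨅ j ∈ J, LinearMap.ker (LinearMap.proj j)
  have hZ : ∀ z, z ∈ Z ↔ ∀ j ∈ J, z j = 0 := fun z => by simp [Z]
  let U : Submodule ℚ (Fin n → ℚ) := R ⊔ Z
  have hsingle_notMem : ∀ j ∈ J, (Pi.single j (1 : ℚ) : Fin n → ℚ) ∉ U := by
    intro j hj hmem
    obtain ⟨r', hr', z, hz, hsum⟩ := Submodule.mem_sup.1 hmem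
    have hr'eq : r' = Pi.single j 1 := by
      funext i
      have hi := congr_fun hsum i
      simp only [Pi.add_apply] at hi
      by_cases hij : i = j
      · subst hij
        rw [(hZ z).1 hz i hj, add_zero] at hi
        exact hi
      · by_cases hiJ : i ∈ J
        · rw [(hZ z).1 hz i hiJ, add_zero] at hi
          exact hi
        · rw [hnotJ i hiJ r' hr', Pi.single_eq_of_ne hij]
    have : E (Pi.single j 1) = 0 := by rw [← hr'eq]; exact hr'
    rw [Fintype.linearCombination_apply_single, one_smul] at this
    exact hδ j this
  obtain ⟨f, hfU, hf⟩ : ∃ f ∈ U.dualAnnihilator, ∀ j : J, f (Pi.single (j : Fin n) 1) ≠ 0 := by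
    let fam : J → Module.Dual ℚ (Module.Dual ℚ (Fin n → ℚ)) := fun j =>
      Module.Dual.eval ℚ (Fin n → ℚ) (Pi.single (j : Fin n) 1)
    have hw : ∀ j, ∃ f ∈ U.dualAnnihilator, fam j f ≠ 0 := fun j => by
      obtain ⟨f, hfx, hfU⟩ := Submodule.exists_dual_map_eq_bot_of_notMem
        (hsingle_notMem j j.2) inferInstance
      refine ⟨f, (Submodule.mem_dualAnnihilator f).2 fun u hu => ?_, hfx⟩
      have : f u ∈ U.map f := Submodule.mem_map_of_mem hu
      rwa [hfU, Submodule.mem_bot] at this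
    obtain ⟨f, hfU, hf⟩ :=
      Module.Dual.exists_forall_mem_ne_zero_of_forall_exists U.dualAnnihilator fam hw
    exact ⟨f, hfU, hf⟩
  have hfR : ∀ x ∈ R, f x = 0 := fun x hx =>
    (Submodule.mem_dualAnnihilator f).1 hfU x (Submodule.mem_sup_left hx)
  have hfZ : ∀ i, i ∉ J → f (Pi.single i 1) = 0 := fun i hi =>
    (Submodule.mem_dualAnnihilator f).1 hfU _ (Submodule.mem_sup_right ((hZ _).2 fun j hj => by
      rw [Pi.single_eq_of_ne]
      rintro rfl
      exact hi hj))
  -- (3c) integral exponents `a` with `a_i f(e_i) = d r_i`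
  let q : Fin n → ℚ := fun i => r i / f (Pi.single i 1)
  obtain ⟨d, a, hd, ha⟩ := localTubeSpan_exists_common_den q
  have haf : ∀ i, (a i : ℚ) * f (Pi.single i 1) = d * r i := fun i => by
    rw [ha i]
    by_cases hi : i ∈ J
    · have hfi : f (Pi.single i 1) ≠ 0 := hf ⟨i, hi⟩
      simp only [q]
      rw [mul_assoc, div_mul_cancel₀ _ hfi]
    · rw [hfZ i hi, hnotJ i hi r hrR, mul_zero, mul_zero]
  -- (3d) the detecting element
  obtain ⟨g, hg, hφg⟩ := hreal a
  obtain ⟨w, hw⟩ := hund g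
  -- the relation produced by undetectedness at `g`
  have hrel : E (fun i => (a i : ℚ) * (α i + B w (δ i))) = 0 := by
    rw [hE]
    have : (φ : G → A.V) g = -∑ i, ((a i : ℚ) * B w (δ i)) • δ i := by
      rw [← hw, hg]; abel
    rw [hφg] at this
    have e : ∑ i, ((a i : ℚ) * (α i + B w (δ i))) • δ i =
        ∑ i, ((a i : ℚ) * α i) • δ i + ∑ i, ((a i : ℚ) * B w (δ i)) • δ i := by
      rw [← Finset.sum_add_distrib]
      refine Finset.sum_congr rfl fun i _ => ?_
      rw [mul_add, add_smul]
    rw [e, this, neg_add_cancel]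
  have hzero : f (fun i => (a i : ℚ) * (α i + B w (δ i))) = 0 := hfR _ hrel
  -- but `f` of that vector is `d · (ℓ r + B w (E r)) = d · ℓ r ≠ 0`
  have hexpand : ∀ c : Fin n → ℚ, f c = ∑ i, c i * f (Pi.single i 1) := fun c => by
    conv_lhs => rw [← Finset.univ_sum_single c]
    rw [map_sum]
    refine Finset.sum_congr rfl fun i _ => ?_
    rw [show (Pi.single i (c i) : Fin n → ℚ) = c i • Pi.single i 1 by
      ext j; by_cases h : j = i
      · subst h; simp
      · simp [Pi.single_eq_of_ne h], map_smul, smul_eq_mul]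
  have hBw : B w (E r) = 0 := by rw [show E r = 0 from hrR, map_zero]
  have hval : f (fun i => (a i : ℚ) * (α i + B w (δ i))) = d * ℓ r := by
    rw [hexpand, hℓ, Finset.mul_sum]
    have e1 : ∀ i, (a i : ℚ) * (α i + B w (δ i)) * f (Pi.single i 1) =
        d * (r i * α i) + d * (r i * B w (δ i)) := fun i => by
      have := haf i
      linear_combination (α i + B w (δ i)) * this
    simp only [e1, Finset.sum_add_distrib, ← Finset.mul_sum]
    have e2 : ∑ i, r i * B w (δ i) = B w (E r) := by
      rw [hE, map_sum]
      simp only [map_smul, smul_eq_mul]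
    rw [e2, hBw, mul_zero, add_zero]
  rw [hval] at hzero
  exact hr.2 ((mul_eq_zero.1 hzero).resolve_left (Nat.cast_ne_zero.2 hd.ne'))

end Rational

end Summit.HodgeConjecture.HodgeConjecture.Theorems

end
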